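import Summits.BirchSwinnertonDyer.BirchSwinnertonDyer.Theorems.ErratumRoadFiveKernelFromPrintB
import Summits.BirchSwinnertonDyer.BirchSwinnertonDyer.Theorems.ErratumRoadFiveRest3TorsionBranchB
import HarnessLib

/-!
# Route `ErratumRoadFive` (K2, `p ≥ 5`) — «19061 from PRINT + H3♭ᴮ + the two VALUE-FREE residuals», RE-ORIENTED:
# the B-twin of `KernelFromPrint.openInputIMCBody_of_print_of_core_of_imcDivSomeFrame` (bdp g12 p446030)

Cell `bsd-stepL` (run/shared/lean/pub/bsd-stepL/), seat `bsd-stepL-bdp` (prover g17, 2026-08-27; the B-twin listed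
as NOT done in g16's census A-3 and in referee g42's VERDICT-CENSUS-A3 (C5)). `--supports
stmt-BirchSwinnertonDyer-19282 --as helper`. THEOREMS ONLY; Theses-free (imports imc-p1 g9's ∕ imc24b g4's
`KernelFromPrintB` and bdp g16's `Rest3TorsionBranchB`), hence citable from K2's `closes` and from the 19282 ∕
19624 skeletons.

* `KernelFromPrintB.openInputIMCBody_of_print_of_coreB_of_imcDivSomeFrameB` — route p2's composite open input
  `P2OpenInputOnTreeAt W p` at EVERY pair from (VN_p) (`hVN`), the re-oriented H3♭ `P2.IMCDivIntCoreFrameAtErratumDataB`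
  at every erratum datum (`h3`), item 19283's facts (`hF`), Wuthrich (`hWu`), JSW 3.3.1-mult (`h331`), the JIMJ18 BDP
  display (`hB`) and the two VALUE-FREE residuals in their ORIENTED form: (2.4)∃♭ᴮ `P2.IMCDivSomeFrameOnTreeB` on the
  (ram) pairs with no erratum datum (`hrestD`) and on the ¬(ram) pairs (`hOffD`) — = `KernelFromPrintB.…_of_rest3_of_notRam`
  ∘ `Rest3TorsionBranchB.openInputOnTreeAt_of_imcDivSomeFrameB_of_pNew`. Every binder except `h3`, `hrestD`, `hOffD`
  BYTE-IDENTICAL to the A kernel p446030; `_intCast` twin for the `(p : ℤ) ∣ …` spelling.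

HONEST FRAMING: implications only; (2.4)∃♭ᴮ has no printed supplier on these rows (ROAD B12, p507771, is a LINE
into it); nothing is discharged, booked or re-labelled (T7).
References: [Castella2018Exceptional] Thms. 2.10–2.11; [Castella2018Erratum] (2.4), Thm. 1.1; [Castella2018] Thms. 2.3,
3.1, 3.2, §5; [JetchevSkinnerWan2017] Thm. 3.3.1; [Wuthrich2014] Prop. 21; cell audit ORIENT-AUDIT-19270 (form (a)).
-/

set_option autoImplicit false
set_option linter.dupNamespace false

noncomputable section

open scoped Classical Topology
open Filter WeierstrassCurve NumberField IsDedekindDomain Field PowerSeries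
open Literature.NumberTheory.EllipticCurves Literature.NumberTheory.EllipticCurves.GreenbergSelmer
open Literature.NumberTheory.EllipticCurves.ModularForms
open Literature.NumberTheory.EllipticCurves.Rank1Residual
open Literature.NumberTheory.EllipticCurves.Rank1Residual.Typed
open Literature.NumberTheory.EllipticCurves.Wuthrich2014
open Literature.NumberTheory.EllipticCurves.Castella2018
open Literature.NumberTheory.EllipticCurves.Castella2018Exceptional
open Literature.NumberTheory.EllipticCurves.JetchevSkinnerWan2017
open Literature.NumberTheory.GaloisRepresentations
open Literature.NumberTheory.GaloisCohomology
open Summit.BirchSwinnertonDyer.Rank1Residual Summit.BirchSwinnertonDyer.Rank1Residual.X11b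
open Summit.BirchSwinnertonDyer.Rank1Residual.X11b.AcSelmer
open Summit.BirchSwinnertonDyer.Rank1Residual.X11b.Halves
open Summit.BirchSwinnertonDyer.BirchSwinnertonDyer.Theorems.Rest3TorsionBranchB

namespace Summit.BirchSwinnertonDyer.BirchSwinnertonDyer.Theorems.KernelFromPrintB

/-- **KERNEL FORM OF «19061 from print», RE-ORIENTED, VALUE-FREE RESIDUALS**: `∀ W p, P2OpenInputOnTreeAt W p` from
(VN_p), H3♭ᴮ at erratum data, the published ∕ cited facts, Wuthrich, JSW 3.3.1-mult, the JIMJ18 display and the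
ORIENTED value-free atom (2.4)∃♭ᴮ on the two no-road residual loci (REST‴ and ¬(ram)). Pure composition of
`openInputIMCBody_of_print_of_coreB_of_rest3_of_notRam` with bdp g16's oriented T = 0 passage
`Rest3TorsionBranchB.openInputOnTreeAt_of_imcDivSomeFrameB_of_pNew`. CONDITIONAL; nothing booked.
[claim: Castella2018Erratum, status: under-review]
[cite: Castella2018Exceptional, Thms. 2.10–2.11 (arXiv:1507.04260 pp. 13–14)]
[cite: Castella2018Erratum, (2.4) and Thm. 1.1 (pp. 1, 4)] [cite: Castella2018, Thms. 2.3, 3.1, 3.2, §5]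
[cite: JetchevSkinnerWan2017, Thm. 3.3.1 (pp. 16–17)] [cite: Wuthrich2014, Prop. 21 (p. 400)] -/
theorem openInputIMCBody_of_print_of_coreB_of_imcDivSomeFrameB
    (hVN : castella2018Exceptional_bdpValueContinuity_trivialChar)
    (hB : thm210_thm211_bdpDisplay_pNew)
    (h3 : ∀ (W : WeierstrassCurve ℚ) [W.IsElliptic] [W.IsGloballyMinimal] (p : ℕ) [Fact p.Prime],
      P2.IMCDivIntCoreFrameAtErratumDataB W p)
    (hF : GrossZagier1986_thm_I_7_3 ∧ rank_eq_analyticRank_of_analyticRank_le_one ∧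
      Skinner2016.thmC_padicValRat_bsd_rank_zero ∧ exists_isNewformOf ∧
      CaiShuTian2014.thm11_trivialChar ∧ friedbergHoffstein_exists_twist_ne_zero_ramifiedAt ∧
      mazur_not_dvd_maninConstant_of_odd ∧
      (∀ (N : ℕ) [NeZero N] (W : WeierstrassCurve ℚ) (K : Type) [Field K] [NumberField K],
        gross_zagier N W K) ∧
      (∀ (N : ℕ) [NeZero N] (W : WeierstrassCurve ℚ) (K : Type) [Field K] [NumberField K],
        kolyvagin N W K) ∧
      (∀ (N : ℕ) [NeZero N] (W : WeierstrassCurve ℚ) (K : Type) [Field K] [NumberField K],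
        Kolyvagin1990_padicValNat_card_sha_le N W K) ∧
      HoffsteinLuo1997_exists_twist_L_one_ne_zero ∧
      (∀ (K : Type) [Field K] [NumberField K], poitouTate_sum_localTatePairing_eq_zero K) ∧
      (∀ (K : Type) [Field K] [NumberField K], poitouTate_selmerStructure_duality K) ∧
      (∀ (K : Type) [Field K] [NumberField K], poitouTate_sha_tateDual K) ∧
      (∀ (K : Type) [Field K] [NumberField K] (v : HeightOneSpectrum (𝓞 K)),
        localEulerPoincareCharacteristic (v.adicCompletion K)) ∧
      fieldCdLE_two_of_numberField)
    (hWu : sha_dvd_analyticSha) (h331 : thm331_anticyclotomicControl_mult)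
    (hrestD : ∀ (W : WeierstrassCurve ℚ) [W.IsElliptic] [W.IsGloballyMinimal] (p : ℕ) [Fact p.Prime],
      Ram W p →
      ¬ ((∃ (q : ℕ) (_ : Fact q.Prime), q ≠ 2 ∧ q ≠ p ∧ Mult W q ∧
            ¬ W.HasSplitMultiplicativeReductionAtPrime q ∧
            ¬ p ∣ padicValInt q W.minimalDiscriminantInt) ∧
          (∀ P : (W.baseChange ℚ_[p]).toAffine.Point, p • P = 0 → P = 0)) →
      P2.IMCDivSomeFrameOnTreeB W p)
    (hOffD : ∀ (W : WeierstrassCurve ℚ) [W.IsElliptic] [W.IsGloballyMinimal] (p : ℕ) [Fact p.Prime],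
      ¬ Ram W p → P2.IMCDivSomeFrameOnTreeB W p) :
    ∀ (W : WeierstrassCurve ℚ) [W.IsElliptic] [W.IsGloballyMinimal] (p : ℕ) [Fact p.Prime],
      P2OpenInputOnTreeAt W p := by
  have hF₀ := hF
  obtain ⟨-, hGZK, -, hnf, -, -, -, -, hKo, -, -, hPT, -, -, hEP, -⟩ := hF₀
  exact openInputIMCBody_of_print_of_coreB_of_rest3_of_notRam hVN h3 hF hWu h331
    (fun W _ _ p _ hram hno ↦
      openInputOnTreeAt_of_imcDivSomeFrameB_of_pNew hnf hGZK hKo hPT hEP hB (hrestD W p hram hno))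
    (fun W _ _ p _ hnr ↦ openInputOnTreeAt_of_imcDivSomeFrameB_of_pNew hnf hGZK hKo hPT hEP hB (hOffD W p hnr))

/-- **Twin with the `(p : ℤ) ∣ padicValInt …` spelling** of the valuation clause in the REST‴ locus (as the A twin
`openInputIMCBody_of_print_of_core_of_imcDivSomeFrame_intCast`). CONDITIONAL; nothing booked.
[claim: Castella2018Erratum, status: under-review]
[cite: Castella2018Exceptional, Thms. 2.10–2.11 (arXiv:1507.04260 pp. 13–14)]
[cite: Castella2018Erratum, (2.4) and Thm. 1.1 (pp. 1, 4)] [cite: Castella2018, Thms. 2.3, 3.1, 3.2, §5] -/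
theorem openInputIMCBody_of_print_of_coreB_of_imcDivSomeFrameB_intCast
    (hVN : castella2018Exceptional_bdpValueContinuity_trivialChar)
    (hB : thm210_thm211_bdpDisplay_pNew)
    (h3 : ∀ (W : WeierstrassCurve ℚ) [W.IsElliptic] [W.IsGloballyMinimal] (p : ℕ) [Fact p.Prime],
      P2.IMCDivIntCoreFrameAtErratumDataB W p)
    (hF : GrossZagier1986_thm_I_7_3 ∧ rank_eq_analyticRank_of_analyticRank_le_one ∧
      Skinner2016.thmC_padicValRat_bsd_rank_zero ∧ exists_isNewformOf ∧
      CaiShuTian2014.thm11_trivialChar ∧ friedbergHoffstein_exists_twist_ne_zero_ramifiedAt ∧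
      mazur_not_dvd_maninConstant_of_odd ∧
      (∀ (N : ℕ) [NeZero N] (W : WeierstrassCurve ℚ) (K : Type) [Field K] [NumberField K],
        gross_zagier N W K) ∧
      (∀ (N : ℕ) [NeZero N] (W : WeierstrassCurve ℚ) (K : Type) [Field K] [NumberField K],
        kolyvagin N W K) ∧
      (∀ (N : ℕ) [NeZero N] (W : WeierstrassCurve ℚ) (K : Type) [Field K] [NumberField K],
        Kolyvagin1990_padicValNat_card_sha_le N W K) ∧
      HoffsteinLuo1997_exists_twist_L_one_ne_zero ∧
      (∀ (K : Type) [Field K] [NumberField K], poitouTate_sum_localTatePairing_eq_zero K) ∧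
      (∀ (K : Type) [Field K] [NumberField K], poitouTate_selmerStructure_duality K) ∧
      (∀ (K : Type) [Field K] [NumberField K], poitouTate_sha_tateDual K) ∧
      (∀ (K : Type) [Field K] [NumberField K] (v : HeightOneSpectrum (𝓞 K)),
        localEulerPoincareCharacteristic (v.adicCompletion K)) ∧
      fieldCdLE_two_of_numberField)
    (hWu : sha_dvd_analyticSha) (h331 : thm331_anticyclotomicControl_mult)
    (hrestD : ∀ (W : WeierstrassCurve ℚ) [W.IsElliptic] [W.IsGloballyMinimal] (p : ℕ) [Fact p.Prime],
      Ram W p →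
      ¬ ((∃ (q : ℕ) (_ : Fact q.Prime), q ≠ 2 ∧ q ≠ p ∧ Mult W q ∧
            ¬ W.HasSplitMultiplicativeReductionAtPrime q ∧
            ¬ (p : ℤ) ∣ (padicValInt q W.minimalDiscriminantInt : ℤ)) ∧
          (∀ P : (W.baseChange ℚ_[p]).toAffine.Point, p • P = 0 → P = 0)) →
      P2.IMCDivSomeFrameOnTreeB W p)
    (hOffD : ∀ (W : WeierstrassCurve ℚ) [W.IsElliptic] [W.IsGloballyMinimal] (p : ℕ) [Fact p.Prime],
      ¬ Ram W p → P2.IMCDivSomeFrameOnTreeB W p) :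
    ∀ (W : WeierstrassCurve ℚ) [W.IsElliptic] [W.IsGloballyMinimal] (p : ℕ) [Fact p.Prime],
      P2OpenInputOnTreeAt W p := by
  refine openInputIMCBody_of_print_of_coreB_of_imcDivSomeFrameB hVN hB h3 hF hWu h331
    (fun W _ _ p _ hram hw ↦ hrestD W p hram fun hw' ↦ hw ?_) hOffD
  obtain ⟨⟨q, hqF, hq2, hqp, hmq, hnsq, hvq⟩, htors⟩ := hw'
  refine ⟨⟨q, hqF, hq2, hqp, hmq, hnsq, fun hd ↦ hvq ?_⟩, htors⟩
  exact_mod_cast hd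

end Summit.BirchSwinnertonDyer.BirchSwinnertonDyer.Theorems.KernelFromPrintB

end
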